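import Literature.Analysis.Complex.PQTypes

/-!
# Pointwise `(p,q)`-types commute with `ℂ`-linear pull-back

Pointwise companion of `Literature/Analysis/Complex/DolbeaultInvariance.lean`
(`typeComponent_pullback`: `(f^*α)^{p,q} = f^*(α^{p,q})` for holomorphic `f`) at the level of a
single alternating form: for a real-linear `U : W →L[ℝ] V` between complex normed spaces that is
`ℂ`-linear (`U (c • w) = c • U w`) and a complex-valued alternating `k`-form `η` on `V`,

* `typeProjAt_compContinuousLinearMap`: `typeProjAt p q (U^*η) = U^*(typeProjAt p q η)`;
* `IsOfTypeAt.compContinuousLinearMap`: pull-back preserves pointwise type.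

(The rotations `e^{iθ}` defining the type projection commute with `U`.) Voisin (2002), §7.3.2
("clearly the pullback of such a form is still of type `(p,q)`"); Huybrechts (2005), §1.3.

## References

* C. Voisin, *Hodge Theory and Complex Algebraic Geometry I* (2002), §2.3.1, §7.3.2. [Voisin2002]
-/

noncomputable section

open Complex ContinuousAlternatingMap Function

namespace Literature.Analysis.Complex

variable {V W : Type*} [NormedAddCommGroup V] [NormedSpace ℂ V] [NormedAddCommGroup W]
  [NormedSpace ℂ W] {k : ℕ}

/-- A `ℂ`-linear map commutes with the rotations `e^{iθ}`. [folklore] -/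
theorem rotateCLM_comp_of_linear (U : W →L[ℝ] V) (hU : ∀ (c : ℂ) (w : W), U (c • w) = c • U w)
    (θ : ℝ) : (rotateCLM θ).comp U = U.comp (rotateCLM θ) := by
  ext w
  simp [hU]

/-- **Pointwise types commute with `ℂ`-linear pull-back**:
`typeProjAt p q (η ∘ U) = (typeProjAt p q η) ∘ U` for `U` real-linear and `ℂ`-linear.
[cite: Voisin2002, §7.3.2] -/
theorem typeProjAt_compContinuousLinearMap (p q : ℕ) (η : V [⋀^Fin k]→L[ℝ] ℂ) (U : W →L[ℝ] V)
    (hU : ∀ (c : ℂ) (w : W), U (c • w) = c • U w) :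
    typeProjAt p q (η.compContinuousLinearMap U) =
      (typeProjAt p q η).compContinuousLinearMap U := by
  rw [typeProjAt_eq, typeProjAt_eq]
  split_ifs with h
  · ext v
    simp only [ContinuousAlternatingMap.smul_apply, ContinuousAlternatingMap.sum_apply,
      compContinuousLinearMap_apply, comp_def, rotateCLM_apply, hU]
  · exact (compContinuousLinearMapₗ U).map_zero.symm

/-- **Pull-back by a `ℂ`-linear map preserves pointwise type.** [cite: Voisin2002, §7.3.2] -/
theorem IsOfTypeAt.compContinuousLinearMap {p q : ℕ} {η : V [⋀^Fin k]→L[ℝ] ℂ}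
    (hη : IsOfTypeAt p q η) (U : W →L[ℝ] V) (hU : ∀ (c : ℂ) (w : W), U (c • w) = c • U w) :
    IsOfTypeAt p q (η.compContinuousLinearMap U) := by
  refine ⟨hη.1, fun θ w ↦ ?_⟩
  simp only [compContinuousLinearMap_apply, comp_def, hU]
  exact hη.2 θ (U ∘ w)

end Literature.Analysis.Complex
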